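import Summits.HubbardSuperconductivity.HubbardSuperconductivity.Theorems.BalabanIRBirComplexStableXYRStubThetaPositive
import HarnessLib

/-!
# Crux `BirComplexStableXYR`, line `fat-gaussian-defect-calculus`: stub `stub_thetaPerturbedPositive`

Registered stub (lead c8, wave 11, skeleton `Cruxes/BirComplexStableXYR/Lines/fat_gaussian_defect_calculus.lean`),
helper (`--supports`) for the crux `Summit.HubbardSuperconductivity.HubbardSuperconductivity.Theses.BalabanIR.BirComplexStableXYR`:
**the perturbed tilted theta series has positive real part** (regime-1 endgame for the vortex-free holonomy series).

**Statement.** For real `E > 0`, real `α`, `ε ≥ 0` and weights `Ξ : ℤ → ℂ` with `‖Ξ h − 1‖ ≤ ε` for all `h`, if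
`ε · (1 + 2/(exp(π²/E) − 1)) < exp(−π²/(4E))` then the series `Σ_{h ∈ ℤ} exp(−E h² + iαh) Ξ(h)` is summable and
its sum has positive real part.

**Proof.** Write the summand as `θ_h + θ_h (Ξ h − 1)` with `θ_h := exp(−E h² + iαh)`, `‖θ_h‖ = exp(−E h²)`
(stub E7's `hsc_thetaPos_norm_term`).
* Main term: by Poisson summation (E7's computation, `Complex.tsum_exp_neg_quadratic`),
  `Σ_h θ_h = c · Σ_n exp(−(π²/E)(n − α/(2π))²)` with `c = 1/(E/π)^{1/2} > 0`; keeping the single term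
  `n₀ = round(α/(2π))`, `|n₀ − α/(2π)| ≤ 1/2` (`abs_sub_round`), gives `Re Σ_h θ_h ≥ c · exp(−π²/(4E))`.
* Error term: `‖Σ_h θ_h (Ξ h − 1)‖ ≤ ε Σ_h exp(−E h²)` (`tsum_of_norm_bounded`), and by the real Poisson formula
  `Real.tsum_exp_neg_mul_int_sq` (`a = E/π`), `Σ_h exp(−E h²) = c · Σ_n exp(−(π²/E) n²) ≤ c · (1 + 2/(exp(π²/E) − 1))`,
  the last step being Mathlib's geometric comparison `HurwitzKernelBounds.F_nat_zero_zero_sub_le` /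
  `F_nat_zero_le` for the two half-sums over `ℕ` (`(n+a)² ≥ n + a²`) and `e^{−x}/(1 − e^{−x}) = 1/(eˣ − 1)`.
* Hence `Re Σ ≥ c · (exp(−π²/(4E)) − ε (1 + 2/(exp(π²/E) − 1))) > 0`.

Elementary given Mathlib and stub E7; no definition and no named fact is introduced; sorry-free. [folklore]
-/

set_option linter.dupNamespace false -- `Summit.<S>.<S>.Theorems…` repeats the summit name (D-0017 layout)

namespace Summit.HubbardSuperconductivity.HubbardSuperconductivity.Theorems.FSUnfolding

open Complex Real

/-- **Abstract perturbation step.** If `θ` is summable with `‖θ_h‖ = g_h`, `Σ g = S`, `‖Ξ_h − 1‖ ≤ ε`,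
`Re Σ θ ≥ M` and `ε S < M`, then `Σ_h θ_h Ξ_h` is summable with positive real part
(`θ Ξ = θ + θ(Ξ − 1)`, `tsum_of_norm_bounded`, `|Re z| ≤ ‖z‖`). [folklore] -/
theorem hsc_thetaPert_abstract {θ Ξ : ℤ → ℂ} {g : ℤ → ℝ} {ε S M : ℝ}
    (hθ : Summable θ) (hnorm : ∀ h, ‖θ h‖ = g h) (hg : HasSum g S) (hΞ : ∀ h, ‖Ξ h - 1‖ ≤ ε)
    (hmain : M ≤ (∑' h, θ h).re) (hpos : ε * S < M) :
    Summable (fun h => θ h * Ξ h) ∧ 0 < (∑' h, θ h * Ξ h).re := by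
  have hbd : ∀ h, ‖θ h * (Ξ h - 1)‖ ≤ ε * g h := fun h => by
    rw [norm_mul, hnorm, mul_comm]
    exact mul_le_mul_of_nonneg_right (hΞ h) ((hnorm h) ▸ norm_nonneg (θ h))
  have herr : Summable (fun h => θ h * (Ξ h - 1)) :=
    Summable.of_norm_bounded (hg.summable.mul_left ε) hbd
  have heq : (fun h => θ h * Ξ h) = fun h => θ h + θ h * (Ξ h - 1) := funext fun h => by ring
  rw [heq]
  refine ⟨hθ.add herr, ?_⟩
  rw [hθ.tsum_add herr, Complex.add_re]
  have h1 : ‖∑' h, θ h * (Ξ h - 1)‖ ≤ ε * S := tsum_of_norm_bounded (hg.mul_left ε) hbd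
  have h2 := (abs_le.mp ((Complex.abs_re_le_norm _).trans h1)).1
  linarith

/-- **Poisson summation for the tilted theta series** (stub E7's computation, recorded as a lemma):
`Σ_h exp(−E h² + iαh) = (1/(E/π)^{1/2}) · Σ_n exp(−(π²/E)(n − α/(2π))²)`, a real number
(`Complex.tsum_exp_neg_quadratic` with `a = E/π`, `b = iα/(2π)`). [folklore] -/
theorem hsc_thetaPert_key (E α : ℝ) (hE : 0 < E) :
    (∑' h : ℤ, Complex.exp (-((E * (h : ℝ) ^ 2 : ℝ) : ℂ) + Complex.I * ((α * (h : ℝ) : ℝ) : ℂ))) =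
      (((1 : ℝ) / (E / π) ^ (1 / 2 : ℝ) *
        ∑' n : ℤ, Real.exp (-(π ^ 2 / E * ((n : ℝ) - α / (2 * π)) ^ 2)) : ℝ) : ℂ) := by
  have ha : 0 < (((E / π : ℝ) : ℂ)).re := by rw [ofReal_re]; positivity
  calc (∑' h : ℤ, Complex.exp (-((E * (h : ℝ) ^ 2 : ℝ) : ℂ) + Complex.I * ((α * (h : ℝ) : ℝ) : ℂ)))
      = ∑' n : ℤ, Complex.exp (-π * ((E / π : ℝ) : ℂ) * n ^ 2 +
          2 * π * (I * ((α / (2 * π) : ℝ) : ℂ)) * n) :=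
        tsum_congr (fun n => (hsc_thetaPos_lhs_term E α n).symm)
    _ = 1 / ((E / π : ℝ) : ℂ) ^ (1 / 2 : ℂ) *
          ∑' n : ℤ, Complex.exp (-π / ((E / π : ℝ) : ℂ) * (n + I * (I * ((α / (2 * π) : ℝ) : ℂ))) ^ 2) :=
        Complex.tsum_exp_neg_quadratic ha _
    _ = (((1 : ℝ) / (E / π) ^ (1 / 2 : ℝ) : ℝ) : ℂ) *
          ∑' n : ℤ, ((Real.exp (-(π ^ 2 / E * ((n : ℝ) - α / (2 * π)) ^ 2)) : ℝ) : ℂ) := by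
        rw [hsc_thetaPos_prefactor E hE, tsum_congr (hsc_thetaPos_rhs_term E α hE)]
    _ = _ := by rw [← ofReal_tsum, ← ofReal_mul]

/-- **Main term lower bound:** keeping the dual Gaussian term nearest to `α/(2π)` (`abs_sub_round`,
`Summable.le_tsum`), `Re Σ_h exp(−E h² + iαh) ≥ (1/(E/π)^{1/2}) · exp(−π²/(4E))`. [folklore] -/
theorem hsc_thetaPert_main_lower (E α : ℝ) (hE : 0 < E) :
    (1 : ℝ) / (E / π) ^ (1 / 2 : ℝ) * Real.exp (-(π ^ 2 / (4 * E))) ≤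
      (∑' h : ℤ, Complex.exp (-((E * (h : ℝ) ^ 2 : ℝ) : ℂ) + Complex.I * ((α * (h : ℝ) : ℝ) : ℂ))).re := by
  rw [hsc_thetaPert_key E α hE, ofReal_re]
  have hS := hsc_thetaPos_gauss_summable E α hE
  refine mul_le_mul_of_nonneg_left ?_ (by positivity)
  obtain ⟨n₀, hn₀⟩ : ∃ n₀ : ℤ, |α / (2 * π) - n₀| ≤ 1 / 2 := ⟨round (α / (2 * π)), abs_sub_round _⟩
  calc Real.exp (-(π ^ 2 / (4 * E)))
      ≤ Real.exp (-(π ^ 2 / E * (((n₀ : ℤ) : ℝ) - α / (2 * π)) ^ 2)) := by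
        have hsq : (((n₀ : ℤ) : ℝ) - α / (2 * π)) ^ 2 ≤ 1 / 4 := by
          have h' : (((n₀ : ℤ) : ℝ) - α / (2 * π)) ^ 2 = |α / (2 * π) - n₀| ^ 2 := by
            rw [sq_abs]; ring
          rw [h']
          nlinarith [abs_nonneg (α / (2 * π) - n₀)]
        rw [Real.exp_le_exp, neg_le_neg_iff]
        calc π ^ 2 / E * (((n₀ : ℤ) : ℝ) - α / (2 * π)) ^ 2 ≤ π ^ 2 / E * (1 / 4) :=
              mul_le_mul_of_nonneg_left hsq (by positivity)
          _ = π ^ 2 / (4 * E) := by ring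
    _ ≤ ∑' n : ℤ, Real.exp (-(π ^ 2 / E * ((n : ℝ) - α / (2 * π)) ^ 2)) :=
        hS.le_tsum n₀ (fun j _ => (Real.exp_pos _).le)

/-- **Geometric tail identity:** `e^{−x}/(1 − e^{−x}) = 1/(eˣ − 1)` for `x > 0`. [folklore] -/
theorem hsc_thetaPert_geom_id (x : ℝ) (hx : 0 < x) :
    Real.exp (-x) / (1 - Real.exp (-x)) = 1 / (Real.exp x - 1) := by
  have hq : 1 < Real.exp x := Real.one_lt_exp_iff.mpr hx
  have hq0 : Real.exp x ≠ 0 := (Real.exp_pos x).ne'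
  have hq1 : Real.exp x - 1 ≠ 0 := sub_ne_zero.mpr hq.ne'
  have hq2 : 1 - Real.exp (-x) ≠ 0 := by
    have : Real.exp (-x) < 1 := Real.exp_lt_one_iff.mpr (by linarith)
    linarith
  rw [div_eq_div_iff hq2 hq1, Real.exp_neg]
  field_simp

/-- **Integer Gaussian sum vs. geometric series** (Mathlib's `HurwitzKernelBounds`, `k = 0`): for `t > 0`,
`Σ_{n ∈ ℤ} exp(−π t n²) ≤ 1 + 2 e^{−πt}/(1 − e^{−πt})`, splitting `ℤ` into `ℕ` and `−ℕ − 1`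
(`tsum_int_rec`) and using `F_nat_zero_zero_sub_le`, `F_nat_zero_le`. [folklore] -/
theorem hsc_thetaPert_int_gauss_le {t : ℝ} (ht : 0 < t) :
    ∑' n : ℤ, Real.exp (-π * t * (n : ℝ) ^ 2) ≤
      1 + 2 * (Real.exp (-π * t) / (1 - Real.exp (-π * t))) := by
  have h0 := HurwitzKernelBounds.summable_f_nat 0 0 ht
  have h1 := HurwitzKernelBounds.summable_f_nat 0 1 ht
  have heq : (fun n : ℤ => Real.exp (-π * t * (n : ℝ) ^ 2)) =
      (Int.rec (HurwitzKernelBounds.f_nat 0 0 t) (HurwitzKernelBounds.f_nat 0 1 t) : ℤ → ℝ) := by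
    funext n
    cases n with
    | ofNat m =>
        simp only [HurwitzKernelBounds.f_nat, Int.ofNat_eq_natCast, Int.cast_natCast, pow_zero, one_mul,
          add_zero]
        congr 1
        ring
    | negSucc m =>
        simp only [HurwitzKernelBounds.f_nat, Int.cast_negSucc, pow_zero, one_mul]
        congr 1
        push_cast
        ring
  rw [heq, tsum_int_rec h0 h1]
  have b0 := HurwitzKernelBounds.F_nat_zero_zero_sub_le ht
  have b1 := HurwitzKernelBounds.F_nat_zero_le zero_le_one ht
  rw [one_pow, mul_one] at b1
  rw [Real.norm_eq_abs] at b0 b1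
  have c0 := (le_abs_self _).trans b0
  have c1 := (le_abs_self _).trans b1
  show HurwitzKernelBounds.F_nat 0 0 t + HurwitzKernelBounds.F_nat 0 1 t ≤ _
  linarith

/-- **Total mass of the integer Gaussian:** `Σ_{h ∈ ℤ} exp(−E h²) ≤ (1/(E/π)^{1/2}) · (1 + 2/(exp(π²/E) − 1))`
for `E > 0` (real Poisson summation `Real.tsum_exp_neg_mul_int_sq` with `a = E/π`, then
`hsc_thetaPert_int_gauss_le` at `t = π/E`). [folklore] -/
theorem hsc_thetaPert_gaussSum_le (E : ℝ) (hE : 0 < E) :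
    ∑' h : ℤ, Real.exp (-(E * (h : ℝ) ^ 2)) ≤
      (1 : ℝ) / (E / π) ^ (1 / 2 : ℝ) * (1 + 2 / (Real.exp (π ^ 2 / E) - 1)) := by
  have hP := Real.tsum_exp_neg_mul_int_sq (by positivity : 0 < E / π)
  have hπ : (π : ℝ) ≠ 0 := Real.pi_ne_zero
  have hl : ∀ n : ℤ, Real.exp (-π * (E / π) * (n : ℝ) ^ 2) = Real.exp (-(E * (n : ℝ) ^ 2)) := by
    intro n; congr 1; field_simp
  have hr : ∀ n : ℤ, Real.exp (-π / (E / π) * (n : ℝ) ^ 2) = Real.exp (-π * (π / E) * (n : ℝ) ^ 2) := by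
    intro n; congr 1; field_simp
  rw [tsum_congr hl, tsum_congr hr] at hP
  rw [hP]
  refine mul_le_mul_of_nonneg_left ?_ (by positivity)
  calc ∑' n : ℤ, Real.exp (-π * (π / E) * (n : ℝ) ^ 2)
      ≤ 1 + 2 * (Real.exp (-π * (π / E)) / (1 - Real.exp (-π * (π / E)))) :=
        hsc_thetaPert_int_gauss_le (by positivity)
    _ = 1 + 2 / (Real.exp (π ^ 2 / E) - 1) := by
        have h1 : -π * (π / E) = -(π ^ 2 / E) := by ring
        rw [h1, hsc_thetaPert_geom_id _ (by positivity), mul_one_div]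

/-- **stub (M): the perturbed tilted theta series is positive (regime-1 endgame).**  For `E > 0`, real `α`, `ε ≥ 0`
and weights `Ξ : ℤ → ℂ` with `‖Ξ h − 1‖ ≤ ε`, if `ε (1 + 2/(e^{π²/E} − 1)) < e^{−π²/(4E)}` then
`Σ_{h∈ℤ} e^{−Eh² + iαh} Ξ(h)` is summable and has POSITIVE real part: the unperturbed sum is the positive real
`√(π/E) Σ_m e^{−(π²/E)(m − α/2π)²} ≥ √(π/E) e^{−π²/(4E)}` (stub E7, Poisson summation), while the perturbation is at
most `ε Σ_h e^{−Eh²} = ε √(π/E) Σ_m e^{−(π²/E)m²} ≤ ε √(π/E)(1 + 2/(e^{π²/E} − 1))` in norm. [folklore] -/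
theorem stub_thetaPerturbedPositive :
    ∀ (E α ε : ℝ), 0 < E → 0 ≤ ε → ∀ (Ξ : ℤ → ℂ), (∀ h : ℤ, ‖Ξ h - 1‖ ≤ ε) →
      ε * (1 + 2 / (Real.exp (Real.pi ^ 2 / E) - 1)) < Real.exp (-(Real.pi ^ 2 / (4 * E))) →
      Summable (fun h : ℤ => Complex.exp (-((E * (h : ℝ) ^ 2 : ℝ) : ℂ) + Complex.I * ((α * (h : ℝ) : ℝ) : ℂ)) * Ξ h) ∧
      0 < (∑' h : ℤ, Complex.exp (-((E * (h : ℝ) ^ 2 : ℝ) : ℂ) + Complex.I * ((α * (h : ℝ) : ℝ) : ℂ)) * Ξ h).re := by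
  intro E α ε hE hε Ξ hΞ hsmall
  have hθ := hsc_thetaPos_lhs_summable E α hE
  have hg : Summable (fun h : ℤ => Real.exp (-(E * (h : ℝ) ^ 2))) :=
    hθ.norm.congr (fun h => hsc_thetaPos_norm_term E α h)
  have hc : 0 < (1 : ℝ) / (E / π) ^ (1 / 2 : ℝ) := by positivity
  refine hsc_thetaPert_abstract hθ (hsc_thetaPos_norm_term E α) hg.hasSum hΞ
    (hsc_thetaPert_main_lower E α hE) ?_
  calc ε * ∑' h : ℤ, Real.exp (-(E * (h : ℝ) ^ 2))
      ≤ ε * ((1 : ℝ) / (E / π) ^ (1 / 2 : ℝ) * (1 + 2 / (Real.exp (π ^ 2 / E) - 1))) :=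
        mul_le_mul_of_nonneg_left (hsc_thetaPert_gaussSum_le E hE) hε
    _ = (1 : ℝ) / (E / π) ^ (1 / 2 : ℝ) * (ε * (1 + 2 / (Real.exp (π ^ 2 / E) - 1))) := by ring
    _ < (1 : ℝ) / (E / π) ^ (1 / 2 : ℝ) * Real.exp (-(π ^ 2 / (4 * E))) :=
        mul_lt_mul_of_pos_left hsmall hc

end Summit.HubbardSuperconductivity.HubbardSuperconductivity.Theorems.FSUnfolding
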